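import Mathlib
import Summits.KontsevichZagierPeriods.Zeta5Search.Families.RayGrowthSymmetry
import Summits.KontsevichZagierPeriods.Zeta5Search.Families.CellularBrownZudilinGrowth
import HarnessLib

/-!
# ζ(5) search — Families: the dihedral symmetry of the Brown–Zudilin eight-parameter family — `bzSup (bzSwap a) = bzSup a`

HONEST FRAMING: systematic search; no irrationality claim unless certified.  STRUCTURAL (size of cellular integrals);
nothing about the arithmetic of any zeta value.  Seat P2, Families layer.

The seating `₈π₈^∨ = pi8dual` has a non-trivial stabiliser in the dihedral relabelling group `D_8 × D_8`: shifting the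
positions by `4` (half-turn of `σδ⁰`), rotating the labels by `1` and reflecting them gives `pi8dual` back
(`pi8dual_stabiliser`, by `decide`).  By the ray symmetries of `Families/RayGrowthSymmetry.lean` this induces an
INVOLUTION of Brown–Zudilin's parameter space,
`bzSwap (a₁,…,a₈) = (a₅, a₄, a₃, a₂, a₁, a₇, a₆, a₄+a₇+a₈−a₂−a₆)` (printed 1-based),
under which the growth constant of the ray is unchanged: **`bzSup_bzSwap : bzSup (bzSwap a) = bzSup a`** for EVERY
`a ∈ ℤ⁸` (no convergence hypothesis).  Any census of Brown–Zudilin directions may therefore be quotiented by `bzSwap`.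
Ingredients of independent use: `rayF_shift_const` / `raySup_shift_const` (general position shifts of a ray) and
`Homogeneous.shift`.  Standard axioms only.
-/

noncomputable section

open Finset

namespace Summit.KontsevichZagierPeriods.Zeta5Search.Families.Cellular

open Literature.NumberTheory.Irrationality

variable {ℓ : ℕ} (σ : Fin (ℓ + 3) → Fin (ℓ + 3)) (α β : Fin (ℓ + 3) → ℤ)

/-! ### General position shifts of a ray -/

/-- `f_{σ(c+·)}(α, β(c+·)) = f_σ(α, β)` pointwise. -/
theorem rayF_shift_const (c : Fin (ℓ + 3)) (t : Fin ℓ → ℝ) :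
    rayF (fun i => σ (c + i)) α (fun i => β (c + i)) t = rayF σ α β t := by
  unfold rayF den
  congr 1
  refine Fintype.prod_equiv (Equiv.addLeft c) _ _ fun i => ?_
  show ef t (σ (c + i)) (σ (c + (i + 1))) ^ β (c + i) = ef t (σ (c + i)) (σ (c + i + 1)) ^ β (c + i)
  rw [add_assoc]

/-- `M_{σ(c+·)}(α, β(c+·)) = M_σ(α, β)`. -/
theorem raySup_shift_const (c : Fin (ℓ + 3)) :
    raySup (fun i => σ (c + i)) α (fun i => β (c + i)) = raySup σ α β := by
  have h : rayF (fun i => σ (c + i)) α (fun i => β (c + i)) = rayF σ α β := funext (rayF_shift_const σ α β c)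
  simp only [raySup, h]

/-- Homogeneity is preserved by position shifts. -/
theorem Homogeneous.shift (hh : Homogeneous σ α β) (c : Fin (ℓ + 3)) :
    Homogeneous (fun i => σ (c + i)) α (fun i => β (c + i)) := by
  intro i
  show α (σ (c + i) - 1) + α (σ (c + i)) = β (c + (i - 1)) + β (c + i)
  rw [← add_sub_assoc]
  exact hh (c + i)

/-! ### The stabiliser of `₈π₈^∨` and the induced involution of the parameters -/

/-- The non-trivial dihedral symmetry of `₈π₈^∨`: positions shifted by `4`, labels rotated by `1` and reflected. -/
theorem pi8dual_stabiliser : (fun i : Fin 8 => reflIdx (pi8dual (4 + i) + 1)) = pi8dual := by decide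

/-- The induced involution of Brown–Zudilin's eight parameters (0-based):
`(a₀,…,a₇) ↦ (a₄, a₃, a₂, a₁, a₀, a₆, a₅, a₃+a₆+a₇−a₁−a₅)`. -/
def bzSwap (a : Fin 8 → ℤ) : Fin 8 → ℤ :=
  ![a 4, a 3, a 2, a 1, a 0, a 6, a 5, a 3 + a 6 + a 7 - a 1 - a 5]

/-- `bzSwap` is an involution. -/
theorem bzSwap_bzSwap (a : Fin 8 → ℤ) : bzSwap (bzSwap a) = a := by
  funext i
  fin_cases i <;> simp [bzSwap]
  ring

/-- The induced map on the `δ⁰`-edge positions is `j ↦ 4 − j`. -/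
theorem reflPos_sub_one_eq : (fun j : Fin (5 + 3) => reflPos j - 1) = ![4, 3, 2, 1, 0, 7, 6, 5] := by decide

/-- The numerator exponents transform into those of `bzSwap a`. -/
theorem bzNum_bzSwap (a : Fin 8 → ℤ) : (fun j : Fin (5 + 3) => bzNum a (reflPos j - 1)) = bzNum (bzSwap a) := by
  have h : (fun j : Fin (5 + 3) => bzNum a (reflPos j - 1)) = fun j => bzNum a ((![4, 3, 2, 1, 0, 7, 6, 5] : Fin 8 → Fin 8) j) := by
    rw [← reflPos_sub_one_eq]
  rw [h]
  funext j
  fin_cases j <;> simp [bzNum, bzSwap]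
  ring

/-- The denominator exponents transform into those of `bzSwap a`. -/
theorem bzDen_bzSwap (a : Fin 8 → ℤ) : (fun i : Fin (5 + 3) => bzDen a (4 + i)) = bzDen (bzSwap a) := by
  funext i
  fin_cases i <;>
    simp [bzDen, bzSwap, BrownZudilin2022.b24, BrownZudilin2022.b14, BrownZudilin2022.b57, BrownZudilin2022.b35,
      BrownZudilin2022.b36, Fin.add_def] <;> ring

/-- **The dihedral symmetry of the Brown–Zudilin family: `bzSup (bzSwap a) = bzSup a`** for every `a ∈ ℤ⁸`. -/
theorem bzSup_bzSwap (a : Fin 8 → ℤ) : bzSup (bzSwap a) = bzSup a := by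
  have hσ : Function.Bijective pi8dual := Finite.injective_iff_bijective.1 pi8dual_injective
  have hb : Function.Bijective fun i : Fin (5 + 3) => pi8dual (4 + i) := hσ.comp (Equiv.addLeft 4).bijective
  have hh : Homogeneous (fun i : Fin (5 + 3) => pi8dual (4 + i)) (bzNum a) (fun i => bzDen a (4 + i)) :=
    Homogeneous.shift pi8dual (bzNum a) (bzDen a) (homogeneous_bz a) 4
  have h1 := raySup_shift_const pi8dual (bzNum a) (bzDen a) 4
  have h2 := raySup_rotate hb hh
  have h3 := raySup_reflect (fun i : Fin (5 + 3) => pi8dual (4 + i) + 1) (fun i => bzNum a (i - 1))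
    (fun i => bzDen a (4 + i))
  unfold bzSup
  rw [← bzNum_bzSwap, ← bzDen_bzSwap]
  calc raySup pi8dual (fun j => bzNum a (reflPos j - 1)) (fun i => bzDen a (4 + i))
      = raySup (fun i : Fin (5 + 3) => reflIdx (pi8dual (4 + i) + 1)) (fun j => bzNum a (reflPos j - 1))
          (fun i => bzDen a (4 + i)) := by rw [pi8dual_stabiliser]
    _ = raySup (fun i : Fin (5 + 3) => pi8dual (4 + i) + 1) (fun i => bzNum a (i - 1)) (fun i => bzDen a (4 + i)) := h3
    _ = raySup (fun i : Fin (5 + 3) => pi8dual (4 + i)) (bzNum a) (fun i => bzDen a (4 + i)) := h2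
    _ = raySup pi8dual (bzNum a) (bzDen a) := h1

/-! ## Appended (P2 g4): the cone and the decay rates are `bzSwap`-invariant -/

/-- `bzSwap` preserves Brown–Zudilin's convergence cone (3): it permutes the seventeen forms. -/
theorem converges_bzSwap {a : Fin 8 → ℤ} (h : BrownZudilin2022.Converges a) :
    BrownZudilin2022.Converges (bzSwap a) := by
  simp [BrownZudilin2022.Converges, BrownZudilin2022.convergenceForms, bzSwap] at h ⊢
  omega

/-- `bzSwap a` converges iff `a` does. -/
theorem converges_bzSwap_iff (a : Fin 8 → ℤ) :
    BrownZudilin2022.Converges (bzSwap a) ↔ BrownZudilin2022.Converges a :=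
  ⟨fun h => by simpa only [bzSwap_bzSwap] using converges_bzSwap h, converges_bzSwap⟩

/-- The rays `a` and `bzSwap a` have the same decay rate: `I(N · bzSwap a)^{1/N} → bzSup a` for `a` in the cone. -/
theorem tendsto_cellularIntegral_root_bzSwap {a : Fin 8 → ℤ} (h : BrownZudilin2022.Converges a) :
    Filter.Tendsto (fun N : ℕ => (BrownZudilin2022.cellularIntegral (fun i => (N : ℤ) * bzSwap a i)) ^ (1 / (N : ℝ)))
      Filter.atTop (nhds (bzSup a)) := by
  rw [← bzSup_bzSwap a]
  exact tendsto_cellularIntegral_root (converges_bzSwap h)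

/-! ## Appended (P2 g4): the record direction and its mirror -/

/-- The mirror of Brown–Zudilin's record direction `(8,16,10,15,12,16,18,13)` is `(12,15,10,16,8,18,16,14)`. -/
theorem bzSwap_record : bzSwap ![8, 16, 10, 15, 12, 16, 18, 13] = ![12, 15, 10, 16, 8, 18, 16, 14] := by
  funext i
  fin_cases i <;> rfl

/-- Hence the mirror direction has EXACTLY the record's growth constant (`log bzSup = −66.0578…`, kernel-enclosed in
`Families/RayGrowthTransportSharp.lean` / `Families/CellularBZRayGrowthConstants.lean`). -/
theorem bzSup_record_mirror : bzSup ![12, 15, 10, 16, 8, 18, 16, 14] = bzSup ![8, 16, 10, 15, 12, 16, 18, 13] := by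
  rw [← bzSwap_record, bzSup_bzSwap]

end Summit.KontsevichZagierPeriods.Zeta5Search.Families.Cellular
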